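import Mathlib
import Literature.Probability.RandomPlanarGeometry.CurveSpace
import Literature.Probability.RandomPlanarGeometry.SimpleCurves
import Literature.Probability.LatticeModels.LatticeInterface
import HarnessLib

/-!
# Polylines as functions of their vertices: continuity, monotone functionals, simplicity

Topic `Literature/Probability/RandomPlanarGeometry`; theorems only, about the tree's polyline
`LatticeModels.polyline (a :: l) = (LatticeModels.polylineFrom a l).2` (iterated `Path.trans` of
`Path.segment`s, dyadic time parametrisation with a constant `Path.refl` tail,
`LatticeInterface.lean`). Written for the off-lattice self-avoiding walk
(`FreelyJointedSAW.lean`), where configuration measures on vertex space are pushed forward to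
the curve space `CurveClass` and the image must be Borel and, on a set of positive measure, simple.

* `Polyline.continuous_polylineFrom_ofFn`, `Polyline.continuous_polyline_ofFn`: the polyline
  through `n + 1` vertices, as a point of `C([0,1], E)` (compact-open topology), depends
  continuously on the vertices (`Path.trans_continuous_family` inductively, then
  `ContinuousMap.continuous_of_continuous_uncurry`).
* `Polyline.apply_polylineFrom_mono`, `Polyline.polylineFrom_eq_of_apply_eq`: if a linear
  functional `φ` increases strictly along the vertices then `φ` is monotone along the polyline,
  and `φ (P s) = φ (P t)`, `s ≤ t`, forces `P` to be constant on `[s, t]` (the only constancy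
  intervals of the dyadic parametrisation are its constant tails); hence the parametrisation is
  FLAT (`Curve.IsFlat`) and non-constant, so by the monotone–light factorisation of
  `SimpleCurves.lean` (`Curve.exists_isSimple_of_isFlat`) its class is a SIMPLE curve class:
  `Polyline.mk_polyline_mem_simple_of_isChain`, `Polyline.mk_polyline_ofFn_mem_simple`.

All statements are elementary real-variable bookkeeping on `Path.trans`/`Path.segment`
(Camia–Newman 2007, §2: lattice paths as polygonal curves; Aizenman–Burchard 1999, §2.1: curves
modulo reparametrisation); tagged [folklore].
-/

noncomputable section

open Set Function
open scoped unitInterval Topology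

namespace Literature.Probability.RandomPlanarGeometry

namespace Polyline

open Literature.Probability.LatticeModels (polyline polylineFrom polylineFrom_nil polylineFrom_cons)

/-! ### Polylines through finitely many varying vertices depend continuously on the vertices -/

section Polyline

variable {E : Type*} [AddCommGroup E] [Module ℝ E] [TopologicalSpace E] [ContinuousAdd E]
  [ContinuousSMul ℝ E]

/-- The straight segments `Path.segment a b` form a jointly continuous family in `(a, b, t)`
(`lineMap a b t = a + t • (b - a)`). [folklore] -/
theorem continuous_segment_family :
    Continuous (↿(fun p : E × E => Path.segment p.1 p.2)) := by
  change Continuous fun q : (E × E) × I => Path.segment q.1.1 q.1.2 q.2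
  simp only [Path.segment_apply, AffineMap.lineMap_apply_module]
  fun_prop

/-- Zero vertices after `a`: `polylineFrom a []` is the constant path (pointwise form, stated for
`List.ofFn` of an empty family). [folklore] -/
theorem polylineFrom_ofFn_zero_apply (a : E) (w : Fin 0 → E) (t : I) :
    (polylineFrom a (List.ofFn w)).2 t = a := by
  rw [List.ofFn_zero]
  rfl

/-- One more vertex: `polylineFrom a [w 0, …, w n]` is the segment to `w 0` followed by the
polyline from `w 0` (pointwise form of `polylineFrom_cons` for `List.ofFn`). [folklore] -/
theorem polylineFrom_ofFn_succ_apply {n : ℕ} (a : E) (w : Fin (n + 1) → E) (t : I) :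
    (polylineFrom a (List.ofFn w)).2 t =
      ((Path.segment a (w 0)).trans (polylineFrom (w 0) (List.ofFn fun i => w i.succ)).2) t := by
  rw [List.ofFn_succ]
  rfl

/-- The polyline through `v 0, …, v n` evaluated at time `t` is the path `polylineFrom (v 0) …`
(pointwise unfolding of `polyline` for `List.ofFn`). [folklore] -/
theorem polyline_ofFn_succ_apply {n : ℕ} (v : Fin (n + 1) → E) (t : I) :
    polyline (List.ofFn v) t = (polylineFrom (v 0) (List.ofFn fun i => v i.succ)).2 t := by
  rw [List.ofFn_succ]
  rfl

/-- The tree's polylines `polylineFrom a [w₀, …, w_{n-1}]` (iterated `Path.trans` of segments)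
are jointly continuous in the vertices and the time parameter. [folklore] -/
theorem continuous_polylineFrom_ofFn : ∀ n : ℕ,
    Continuous (↿(fun p : E × (Fin n → E) => (polylineFrom p.1 (List.ofFn p.2)).2))
  | 0 => by
      change Continuous fun q : (E × (Fin 0 → E)) × I => (polylineFrom q.1.1 (List.ofFn q.1.2)).2 q.2
      simp only [polylineFrom_ofFn_zero_apply]
      fun_prop
  | n + 1 => by
      change Continuous fun q : (E × (Fin (n + 1) → E)) × I =>
        (polylineFrom q.1.1 (List.ofFn q.1.2)).2 q.2
      simp only [polylineFrom_ofFn_succ_apply]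
      exact Path.trans_continuous_family
        (fun p : E × (Fin (n + 1) → E) => Path.segment p.1 (p.2 0))
        (continuous_segment_family.comp (by fun_prop :
          Continuous fun q : (E × (Fin (n + 1) → E)) × I => ((q.1.1, q.1.2 0), q.2)))
        (fun p : E × (Fin (n + 1) → E) => (polylineFrom (p.2 0) (List.ofFn fun i => p.2 i.succ)).2)
        ((continuous_polylineFrom_ofFn n).comp (by fun_prop :
          Continuous fun q : (E × (Fin (n + 1) → E)) × I =>
            ((q.1.2 0, fun i : Fin n => q.1.2 i.succ), q.2)))

/-- The polyline through `n + 1` vertices, as a point of `C([0,1], E)` (compact-open topology),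
depends continuously on the vertices. [folklore] -/
theorem continuous_polyline_ofFn (n : ℕ) :
    Continuous fun v : Fin (n + 1) → E => polyline (List.ofFn v) := by
  apply ContinuousMap.continuous_of_continuous_uncurry
  change Continuous fun q : (Fin (n + 1) → E) × I => polyline (List.ofFn q.1) q.2
  simp only [polyline_ofFn_succ_apply]
  exact (continuous_polylineFrom_ofFn n).comp (by fun_prop :
    Continuous fun q : (Fin (n + 1) → E) × I => ((q.1 0, fun i : Fin n => q.1 i.succ), q.2))

end Polyline

/-! ### Polylines increasing along a linear functional are flat, hence simple classes -/

section Flat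

variable {E : Type*} [AddCommGroup E] [Module ℝ E] [TopologicalSpace E] [ContinuousAdd E]
  [ContinuousSMul ℝ E] (φ : E →ₗ[ℝ] ℝ)

/-- Pointwise form of `Path.trans` through `Path.extend` (this is its definition). [folklore] -/
theorem path_trans_apply_ite {X : Type*} [TopologicalSpace X] {x y z : X} (γ : Path x y)
    (γ' : Path y z) (t : I) :
    γ.trans γ' t = if (t : ℝ) ≤ 1 / 2 then γ.extend (2 * t) else γ'.extend (2 * t - 1) := rfl

/-- A linear functional along a segment: `φ (segment a b t) = φ a + t (φ b - φ a)`. [folklore] -/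
theorem apply_segment (a b : E) (t : I) :
    φ (Path.segment a b t) = φ a + (t : ℝ) * (φ b - φ a) := by
  rw [Path.segment_apply, AffineMap.lineMap_apply_module, map_add, map_smul, map_smul, smul_eq_mul,
    smul_eq_mul]
  ring

/-- A linear functional along an extended segment, for times in `[0, 1]`. [folklore] -/
theorem apply_segment_extend (a b : E) {x : ℝ} (hx : x ∈ Set.Icc (0 : ℝ) 1) :
    φ ((Path.segment a b).extend x) = φ a + x * (φ b - φ a) := by
  rw [Path.extend_apply _ hx, apply_segment]

/-- **Monotonicity.** If `φ` increases strictly along the vertices `a, l₀, l₁, …`, then `φ` is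
monotone along the polyline `polylineFrom a l` (dyadic parametrisation). [folklore] -/
theorem apply_polylineFrom_mono :
    ∀ (l : List E) (a : E), List.IsChain (fun p q => φ p < φ q) (a :: l) →
      ∀ {s t : I}, s ≤ t → φ ((polylineFrom a l).2 s) ≤ φ ((polylineFrom a l).2 t)
  | [], a, _, s, t, _ => le_rfl
  | b :: l, a, h, s, t, hst => by
      rw [List.isChain_cons_cons] at h
      obtain ⟨hab, h'⟩ := h
      have IH := fun {s t : I} (hst : s ≤ t) => apply_polylineFrom_mono l b h' hst
      have hb0 : ∀ u : I, φ b ≤ φ ((polylineFrom b l).2 u) := fun u => by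
        have := IH (s := 0) (t := u) (show (0 : I) ≤ u from u.2.1)
        rwa [Path.source] at this
      change φ (((Path.segment a b).trans (polylineFrom b l).2) s) ≤
        φ (((Path.segment a b).trans (polylineFrom b l).2) t)
      rw [path_trans_apply_ite, path_trans_apply_ite]
      have hs0 := s.2.1; have hs1 := s.2.2; have ht0 := t.2.1; have ht1 := t.2.2
      have hst' : (s : ℝ) ≤ t := hst
      have hd : 0 ≤ φ b - φ a := sub_nonneg.2 hab.le
      split_ifs with hs ht ht
      · rw [apply_segment_extend φ a b ⟨by linarith, by linarith⟩,
          apply_segment_extend φ a b ⟨by linarith, by linarith⟩]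
        have := mul_le_mul_of_nonneg_right (by linarith : 2 * (s : ℝ) ≤ 2 * t) hd
        linarith
      · rw [apply_segment_extend φ a b ⟨by linarith, by linarith⟩,
          Path.extend_apply _ ⟨by linarith, by linarith⟩]
        have := mul_le_mul_of_nonneg_right (by linarith : 2 * (s : ℝ) ≤ 1) hd
        calc φ a + 2 * (s : ℝ) * (φ b - φ a) ≤ φ b := by linarith
          _ ≤ _ := hb0 _
      · exact absurd (hst'.trans ht) hs
      · rw [Path.extend_apply _ ⟨by linarith, by linarith⟩, Path.extend_apply _ ⟨by linarith, by linarith⟩]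
        exact IH (Subtype.mk_le_mk.2 (by linarith))

/-- **Flatness.** If `φ` increases strictly along the vertices, then two times `s ≤ t` with
`φ (P s) = φ (P t)` bound an interval on which the polyline `P = polylineFrom a l` is constant
(the only constancy intervals are the dyadic constant tails). [folklore] -/
theorem polylineFrom_eq_of_apply_eq :
    ∀ (l : List E) (a : E), List.IsChain (fun p q => φ p < φ q) (a :: l) →
      ∀ {s u t : I}, s ≤ u → u ≤ t → φ ((polylineFrom a l).2 s) = φ ((polylineFrom a l).2 t) →
        (polylineFrom a l).2 u = (polylineFrom a l).2 s
  | [], a, _, s, u, t, _, _, _ => rfl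
  | b :: l, a, h, s, u, t, hsu, hut, hφ => by
      rw [List.isChain_cons_cons] at h
      obtain ⟨hab, h'⟩ := h
      have IH := fun {s u t : I} (hsu : s ≤ u) (hut : u ≤ t) =>
        polylineFrom_eq_of_apply_eq l b h' (s := s) (u := u) (t := t) hsu hut
      have mono := fun {s t : I} (hst : s ≤ t) => apply_polylineFrom_mono φ l b h' hst
      have hb0 : ∀ u : I, φ b ≤ φ ((polylineFrom b l).2 u) := fun u => by
        have := mono (s := 0) (t := u) (show (0 : I) ≤ u from u.2.1)
        rwa [Path.source] at this
      change φ (((Path.segment a b).trans (polylineFrom b l).2) s) =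
        φ (((Path.segment a b).trans (polylineFrom b l).2) t) at hφ
      change ((Path.segment a b).trans (polylineFrom b l).2) u =
        ((Path.segment a b).trans (polylineFrom b l).2) s
      rw [path_trans_apply_ite, path_trans_apply_ite] at hφ ⊢
      have hs0 := s.2.1; have hs1 := s.2.2; have ht0 := t.2.1; have ht1 := t.2.2
      have hu0 := u.2.1; have hu1 := u.2.2
      have hsu' : (s : ℝ) ≤ u := hsu
      have hut' : (u : ℝ) ≤ t := hut
      have hd : 0 < φ b - φ a := sub_pos.2 hab
      by_cases ht : (t : ℝ) ≤ 1 / 2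
      · -- everything happens on the first segment, where `φ` is strictly increasing
        have hs : (s : ℝ) ≤ 1 / 2 := by linarith
        have hu : (u : ℝ) ≤ 1 / 2 := by linarith
        rw [if_pos hs, if_pos ht, apply_segment_extend φ a b ⟨by linarith, by linarith⟩,
          apply_segment_extend φ a b ⟨by linarith, by linarith⟩] at hφ
        have hst : (s : ℝ) = t := by
          have h1 : 2 * (s : ℝ) * (φ b - φ a) = 2 * t * (φ b - φ a) := by linarith
          have h2 := mul_right_cancel₀ hd.ne' h1
          linarith
        have hus : u = s := Subtype.ext (by linarith)
        rw [hus]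
      · by_cases hs : (s : ℝ) ≤ 1 / 2
        · -- `s` on the first segment, `t` beyond: forces `s = 1/2` and constancy of the tail
          rw [if_pos hs, if_neg ht, apply_segment_extend φ a b ⟨by linarith, by linarith⟩,
            Path.extend_apply _ ⟨by linarith, by linarith⟩] at hφ
          have h1 : φ a + 2 * (s : ℝ) * (φ b - φ a) ≤ φ b := by
            have := mul_le_mul_of_nonneg_right (by linarith : 2 * (s : ℝ) ≤ 1) hd.le
            linarith
          have h2 := hb0 ⟨2 * (t : ℝ) - 1, by linarith, by linarith⟩
          have hseq : 2 * (s : ℝ) = 1 := by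
            have h3 : φ a + 2 * (s : ℝ) * (φ b - φ a) = φ b := le_antisymm h1 (hφ ▸ h2)
            have h4 : (2 * (s : ℝ) - 1) * (φ b - φ a) = 0 := by linarith
            rcases mul_eq_zero.1 h4 with h5 | h5
            · linarith
            · exact absurd h5 hd.ne'
          have htail : ∀ w : I, w ≤ ⟨2 * (t : ℝ) - 1, by linarith, by linarith⟩ →
              (polylineFrom b l).2 w = b := fun w hw => by
            have := IH (s := 0) (u := w) (t := ⟨2 * (t : ℝ) - 1, by linarith, by linarith⟩)
              (show (0 : I) ≤ w from w.2.1) hw (by rw [Path.source]; linarith)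
            rwa [Path.source] at this
          rw [if_pos hs]
          by_cases hu : (u : ℝ) ≤ 1 / 2
          · have hus : u = s := Subtype.ext (by linarith)
            rw [if_pos hu, hus]
          · rw [if_neg hu, Path.extend_apply _ ⟨by linarith, by linarith⟩,
              htail _ (Subtype.mk_le_mk.2 (by linarith)), hseq, Path.extend_one]
        · -- everything happens on the tail polyline: induction hypothesis
          have hu : ¬ (u : ℝ) ≤ 1 / 2 := fun hu => hs (hsu'.trans hu)
          rw [if_neg hs, if_neg ht, Path.extend_apply _ ⟨by linarith, by linarith⟩,
            Path.extend_apply _ ⟨by linarith, by linarith⟩] at hφ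
          rw [if_neg hu, if_neg hs, Path.extend_apply _ ⟨by linarith, by linarith⟩,
            Path.extend_apply _ ⟨by linarith, by linarith⟩]
          exact IH (Subtype.mk_le_mk.2 (by linarith)) (Subtype.mk_le_mk.2 (by linarith)) hφ

/-- The endpoint of a polyline with `φ`-increasing vertices has a strictly larger `φ`-value than
its starting point (as soon as there is at least one step). [folklore] -/
theorem apply_polylineFrom_zero_lt_one (a b : E) (l : List E)
    (h : List.IsChain (fun p q => φ p < φ q) (a :: b :: l)) :
    φ ((polylineFrom a (b :: l)).2 0) < φ ((polylineFrom a (b :: l)).2 1) := by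
  rw [Path.source, Path.target]
  rw [List.isChain_cons_cons] at h
  obtain ⟨hab, h'⟩ := h
  have := apply_polylineFrom_mono φ l b h' (s := 0) (t := 1) (show (0 : I) ≤ 1 from zero_le_one)
  rw [Path.source, Path.target] at this
  exact hab.trans_le this

end Flat

section FlatSimple

variable {E : Type*} [NormedAddCommGroup E] [NormedSpace ℝ E] (φ : E →ₗ[ℝ] ℝ)

/-- **A polyline whose vertices increase strictly along a linear functional is a simple curve
class**: its dyadic parametrisation is flat and non-constant, hence at reparametrisation distance
`0` from an injective curve (`Curve.exists_isSimple_of_isFlat`). [folklore] -/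
theorem mk_polyline_mem_simple_of_isChain (a b : E) (l : List E)
    (h : List.IsChain (fun p q => φ p < φ q) (a :: b :: l)) :
    CurveClass.mk ⟨polyline (a :: b :: l)⟩ ∈ (CurveClass.simple : Set (CurveClass E)) := by
  set γ : Curve E := ⟨polyline (a :: b :: l)⟩ with hγ
  have hγt : ∀ t, γ t = (polylineFrom a (b :: l)).2 t := fun t => rfl
  have hflat : γ.IsFlat := by
    intro s u t hsu hut hst
    rw [hγt, hγt] at hst ⊢
    exact polylineFrom_eq_of_apply_eq φ (b :: l) a h hsu hut (congrArg φ hst)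
  have h01 : γ 0 ≠ γ 1 := fun h01 => by
    have := apply_polylineFrom_zero_lt_one φ a b l h
    rw [← hγt, ← hγt, h01] at this
    exact lt_irrefl _ this
  obtain ⟨γ₀, hγ₀, -, hdist⟩ := Curve.exists_isSimple_of_isFlat hflat h01
  rw [CurveClass.mk_eq_mk_iff_dist_eq_zero.2 hdist]
  exact CurveClass.mk_mem_simple hγ₀

/-- `Fin`-indexed form: if `φ (v k) < φ (v (k+1))` for all `k`, the polyline class through
`v 0, …, v (N+1)` is simple. [folklore] -/
theorem mk_polyline_ofFn_mem_simple {N : ℕ} (v : Fin (N + 2) → E)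
    (hv : ∀ k : Fin (N + 1), φ (v k.castSucc) < φ (v k.succ)) :
    CurveClass.mk ⟨polyline (List.ofFn v)⟩ ∈ (CurveClass.simple : Set (CurveClass E)) := by
  have hchain : List.IsChain (fun p q => φ p < φ q) (List.ofFn v) := by
    rw [List.isChain_iff_getElem]
    intro i hi
    rw [List.length_ofFn] at hi
    simp only [List.getElem_ofFn]
    exact hv ⟨i, by omega⟩
  have hshape : List.ofFn v = v 0 :: v 1 :: List.ofFn (fun i : Fin N => v i.succ.succ) := by
    rw [List.ofFn_succ, List.ofFn_succ]
    rfl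
  rw [hshape] at hchain ⊢
  exact mk_polyline_mem_simple_of_isChain φ _ _ _ hchain

end FlatSimple

end Polyline

end Literature.Probability.RandomPlanarGeometry
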